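import Literature.NumberTheory.Automorphic.GodementJacquetPartialL
import Literature.NumberTheory.Automorphic.SummableNormSqTraceSatakePowGL2
import HarnessLib

/-!
# Jacquet–Shalika's Thm. (5.3) (holomorphy of `L^S(s, Π)` on `re s > 1`) in rank `n ≤ 2`,
unconditionally

Topic `NumberTheory/Automorphic`; namespace `Literature.NumberTheory.Automorphic`. Proof file
(theorems only: no definition, no named fact, no instance) for the named fact
`JacquetShalika1981_differentiableOn_partialStandardL` of `GodementJacquetPartialL`
(Jacquet–Shalika, *On Euler products and the classification of automorphic representations I*,
Amer. J. Math. **103** (1981), Thm. (5.3) p. 555 with Remark (5.4): for a unitary cuspidal `π` of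
`GL_n(𝔸_K)` and every finite `S` off which `π` is unramified, the Euler product `L_S(s, π)`
converges absolutely on `re s > 1`; in the tree: `L^S(s, Π) = ∏_{v ∉ S} ∏_{a ∈ α v}
(1 - a q_v^{-s})⁻¹` is holomorphic on `re s > 1` for every honest Satake family `α` of `Π` off a
finite `S`).

In `GodementJacquetPartialL` the fact is derived from the single input (5.3.3)–(5.3.4)
`summable_normSq_trace_satakePow` of `AutomorphicLFunctionProofs`
(`JacquetShalika1981_differentiableOn_partialStandardL_of_summable`), and that input is now a
theorem of the tree in rank `n ≤ 2` (`summable_normSq_trace_satakePow_of_le_two` of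
`SummableNormSqTraceSatakePowGL2`: the mean-square route to the bounded torus-sum products for
`GL₂`, `MultipliableLGL2`, together with the rank-two bound `|a| ≤ q_v^{1/2}` of
`SatakeParameterRankTwoBound`; `n ≤ 1`: `SatakeParameterUnitBound`). This leaf file (kept apart
from `GodementJacquetPartialLProofs` so as not to put the `GL₂` mean-square tower under the
Godement–Jacquet files) records the consequences:

* `JacquetShalika1981_differentiableOn_partialStandardL_two`,
  `JacquetShalika1981_differentiableOn_partialStandardL_of_le_two` — **the named fact holds
  unconditionally in rank `n ≤ 2`**: for every cuspidal `Π` of `GL_n(𝔸_K)`, `n ≤ 2`, every finite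
  `S` and every Satake family `α` of `Π` off `S`, `L^S(s, Π)` is holomorphic on `re s > 1`;
* `differentiableOn_and_ne_zero_partialStandardL_of_le_two` — and non-vanishing there, off an
  arbitrary (not necessarily finite) exceptional set `S` (loc. cit. Thm. (5.3), "in particular",
  with Remark (5.4));
* `partialStandardL_hasMeromorphicContinuation_of_GJ_of_le_two`,
  `godementJacquet_hasMeromorphicContinuation_of_GJ_of_le_two` — in rank `n ≤ 2` the two lang.S21
  meromorphic-continuation facts of `AutomorphicLFunctions` rest on Godement–Jacquet's
  continuation from a right half-plane (`GodementJacquet1972_meromorphic_partialStandardL`,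
  LNM 260, Thm. 13.8 with Thm. 3.3) **alone** (for `n ≤ 1` cf.
  `partialStandardL_hasMeromorphicContinuation_of_GJ_of_le_one` of `GLOneStandardLTate`, where the
  Godement–Jacquet input is moreover discharged from Tate's thesis).

For `n ≥ 3` the frontier of `JacquetShalika1981_differentiableOn_partialStandardL_holds` is
unchanged: Lemma (5.2) of the source (`JacquetShalika1981_continuation_partialPairL_conj`), alone
for `n ≤ 3` (`JacquetShalika1981_differentiableOn_partialStandardL_of_lemma52_of_le_three` of
`SatakeParameterHeckeBound`) and together with the local bound (5.1.3)
`norm_satakeParameter_le_sqrt` for `n ≥ 4` (`JacquetShalika1981_differentiableOn_partialStandardL_of_lemma52`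
of `GodementJacquetPartialLProofs`); equivalently the single input
`summable_normSq_trace_satakePow` in every rank.

## References

* H. Jacquet, J. A. Shalika, *On Euler products and the classification of automorphic
  representations I*, Amer. J. Math. 103 (1981), 499–558: Thm. (5.3) p. 555, proof
  (5.3.3)–(5.3.4) p. 556, Remark (5.4) p. 557 [JacquetShalikaAJM1981].
* R. Godement, H. Jacquet, *Zeta functions of simple algebras*, Lecture Notes in Math. 260
  (1972): Thm. 13.8 with Thm. 3.3 [GodementJacquet1972].
-/

noncomputable section

open MeasureTheory NumberField IsDedekindDomain Complex

namespace Literature.NumberTheory.Automorphic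

variable {K : Type} [Field K] [NumberField K]

section Two

variable {μ : Measure (AdelicGroupData.gl 2 K).automorphicQuotient}
  [(AdelicGroupData.gl 2 K).IsAutomorphicMeasure μ]

/-- **Jacquet–Shalika's Thm. (5.3) for `GL₂`, holomorphy form**: for every cuspidal `Π` of
`GL₂(𝔸_K)`, every finite `S` and every Satake family `α` of `Π` off `S`, the partial standard
L-function `L^S(s, Π)` is holomorphic on `re s > 1` — the named fact
`JacquetShalika1981_differentiableOn_partialStandardL` for `n = 2`, unconditionally
(`JacquetShalika1981_differentiableOn_partialStandardL_of_summable` with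
`summable_normSq_trace_satakePow_two`). [cite: JacquetShalikaAJM1981, Thm. (5.3), Remark (5.4)] -/
theorem JacquetShalika1981_differentiableOn_partialStandardL_two :
    JacquetShalika1981_differentiableOn_partialStandardL (n := 2) (K := K) (μ := μ) :=
  JacquetShalika1981_differentiableOn_partialStandardL_of_summable
    summable_normSq_trace_satakePow_two

end Two

section LeTwo

variable {n : ℕ} {μ : Measure (AdelicGroupData.gl n K).automorphicQuotient}
  [(AdelicGroupData.gl n K).IsAutomorphicMeasure μ]

/-- **The named fact `JacquetShalika1981_differentiableOn_partialStandardL` holds unconditionally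
in rank `n ≤ 2`** (`summable_normSq_trace_satakePow_of_le_two`).
[cite: JacquetShalikaAJM1981, Thm. (5.3), Remark (5.4)] -/
theorem JacquetShalika1981_differentiableOn_partialStandardL_of_le_two (hn : n ≤ 2) :
    JacquetShalika1981_differentiableOn_partialStandardL (n := n) (K := K) (μ := μ) :=
  JacquetShalika1981_differentiableOn_partialStandardL_of_summable
    (summable_normSq_trace_satakePow_of_le_two hn)

/-- **`L^S(s, Π)` is holomorphic and non-zero on `re s > 1` for cuspidal `Π` of `GL_n(𝔸_K)`,
`n ≤ 2`, off an arbitrary exceptional set `S`** (Jacquet–Shalika (1981), Thm. (5.3): "the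
infinite product … is absolutely convergent in the half-plane `Re(s) > 1`. In particular the
function `L_S(s, π × π')` does not vanish for `Re(s) > 1`", case `π' = 1` of Remark (5.4)), from
`differentiableOn_partialStandardL_of_summable` and `partialStandardL_ne_zero_of_summable` with
`summable_normSq_trace_satakePow_of_le_two`. [cite: JacquetShalikaAJM1981, Thm. (5.3), Remark (5.4)] -/
theorem differentiableOn_and_ne_zero_partialStandardL_of_le_two (hn : n ≤ 2)
    (P : CuspidalAutomorphicRepGL n K μ) {S : Set (HeightOneSpectrum (𝓞 K))} {α : SatakeFamily K}
    (hα : IsSatakeFamilyOf P S α) :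
    DifferentiableOn ℂ (partialStandardL S α) {s : ℂ | 1 < s.re} ∧
      ∀ s : ℂ, 1 < s.re → partialStandardL S α s ≠ 0 :=
  ⟨differentiableOn_partialStandardL_of_summable (summable_normSq_trace_satakePow_of_le_two hn) P hα,
    fun _ hs => partialStandardL_ne_zero_of_summable (summable_normSq_trace_satakePow_of_le_two hn)
      P hα hs⟩

/-- **lang.S21 (partial L-functions) in rank `n ≤ 2` from Godement–Jacquet's Thm. 13.8 alone**:
`partialStandardL_hasMeromorphicContinuation` from `GodementJacquet1972_meromorphic_partialStandardL`
(continuation of `L^S(s, Π)` from a right half-plane), the holomorphy on `re s > 1` being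
`JacquetShalika1981_differentiableOn_partialStandardL_of_le_two`.
[cite: GodementJacquet1972, Thm. 13.8] [cite: JacquetShalikaAJM1981, Thm. (5.3)] -/
theorem partialStandardL_hasMeromorphicContinuation_of_GJ_of_le_two (hn : n ≤ 2)
    (h₁ : GodementJacquet1972_meromorphic_partialStandardL (μ := μ)) :
    partialStandardL_hasMeromorphicContinuation (μ := μ) :=
  partialStandardL_hasMeromorphicContinuation_of_halfPlane h₁
    (JacquetShalika1981_differentiableOn_partialStandardL_of_le_two hn)

/-- **lang.S21 (meromorphic continuation of `L(s, Π)`, all cuspidal `Π`) in rank `n ≤ 2` from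
Godement–Jacquet's Thm. 13.8 alone** (`godementJacquet_hasMeromorphicContinuation_of_halfPlane`
with `JacquetShalika1981_differentiableOn_partialStandardL_of_le_two`).
[cite: GodementJacquet1972, Thm. 13.8] [cite: JacquetShalikaAJM1981, Thm. (5.3)] -/
theorem godementJacquet_hasMeromorphicContinuation_of_GJ_of_le_two (hn : n ≤ 2)
    (h₁ : GodementJacquet1972_meromorphic_partialStandardL (μ := μ)) :
    godementJacquet_hasMeromorphicContinuation (μ := μ) :=
  godementJacquet_hasMeromorphicContinuation_of_halfPlane h₁
    (JacquetShalika1981_differentiableOn_partialStandardL_of_le_two hn)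

end LeTwo

end Literature.NumberTheory.Automorphic
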